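import Literature.NumberTheory.DiophantineGeometry.GenEllPrimesPrescribed
import HarnessLib

/-!
# [GenEll] Thm 3.8, proof: the image of `Gal(Q̄/L′)` on `E[m]` is contained in that of `Gal(Q̄/L)`
# — transport of `ImageModLContainsSL2` down a finite extension `L ⊆ L′`

S. Mochizuki, *Arithmetic elliptic curves in general position*, Math. J. Okayama Univ. **52** (2010)
[cite: MochizukiGenEll2010], proof of Theorem 3.8, p. 20:

> […] there exists a Galois extension `L′` of `L` of degree that divides `d₀ = 23040` […] we may
> assume that `E_{L′} := E_L ×_L L′` has semi-stable reduction […] Thus, we conclude from Lemma 3.1,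
> (iv), that the image of Galois in `GL₂(ℤ_l)` contains `SL₂(ℤ_l)`, as desired.

The conclusion is obtained for `E_{L′}` (i.e. for `Gal(Q̄/L′)`) and is a fortiori true for the larger
group `Gal(Q̄/L)`.  In the tree's model a presented point `P = (F, W)` carries its own algebraic
closure `AlgebraicClosure F`, so "a fortiori" is a transport: for a finite extension `F ⊆ F′` and the
base-changed presentation `P′ = (F′, W ⊗_F F′)`, an `F`-isomorphism `ι : F̄ ≃ F̄′` of algebraic closures
(Mathlib's `IsAlgClosure.equiv`) identifies `E[m](F̄)` with `E[m](F̄′)` compatibly with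
`σ′ ↦ ι⁻¹ σ′ ι : Gal(F̄′/F′) → Gal(F̄/F)`.  PROVED here:

* `EllPoint.imageModLContainsSL2_of_baseChange` — `ImageModLContainsSL2 (F′, W_{F′}) m →
  ImageModLContainsSL2 (F, W) m`; hence the same for `LAdicImageContainsSL2`-type conjunctions level
  by level.

Proof-only; no definitions (the base-changed presentation is written `EllPoint.mk F′ (W.map (algebraMap F F′))`).
-/

noncomputable section

open scoped Classical
open WeierstrassCurve

namespace Literature.NumberTheory.DiophantineGeometry.GenEll

namespace EllPoint

variable (P : EllPoint) (F' : Type) [Field F'] [NumberField F'] [Algebra P.F F']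

/-- **The image of `Γ_{F′}` on `E[m]` lies in the image of `Γ_F`** (transport along an
`F`-isomorphism of algebraic closures `F̄ ≃ F̄′`): if every `ℤ/m`-linear endomorphism of `E[m](F̄′)`
of determinant `1` is the action of an element of `Gal(F̄′/F′)`, then every `ℤ/m`-linear endomorphism
of `E[m](F̄)` of determinant `1` is the action of an element of `Gal(F̄/F)` — for the base-changed
presentation `(F′, W ⊗_F F′)` of the presented point `(F, W)`. [cite: MochizukiGenEll2010, Thm 3.8 p.20] -/
theorem imageModLContainsSL2_of_baseChange (m : ℕ) [NeZero m]
    (h : (EllPoint.mk F' (P.W.map (algebraMap P.F F'))).ImageModLContainsSL2 m) :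
    P.ImageModLContainsSL2 m := by
  -- the two algebraic closures and an `F`-isomorphism between them
  let K := AlgebraicClosure P.F
  let K' := AlgebraicClosure F'
  let ι : K ≃ₐ[P.F] K' := IsAlgClosure.equiv P.F K K'
  let P' : EllPoint := EllPoint.mk F' (P.W.map (algebraMap P.F F'))
  -- transport of geometric points along `ι` and `ι⁻¹`
  let T : P.W.geomPoints →+ P'.W.geomPoints :=
    Affine.Point.map (W' := P.W) (ι : K →ₐ[P.F] K')
  let Ti : P'.W.geomPoints →+ P.W.geomPoints :=
    Affine.Point.map (W' := P.W) (ι.symm : K' →ₐ[P.F] K)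
  have hmap_id : ∀ x : P.W.geomPoints, Affine.Point.map (W' := P.W) (AlgHom.id P.F K) x = x :=
    fun x => by cases x <;> rfl
  have hmap_id' : ∀ y : P'.W.geomPoints, Affine.Point.map (W' := P.W) (AlgHom.id P.F K') y = y :=
    fun y => by cases y <;> rfl
  have hTiT : ∀ x, Ti (T x) = x := fun x => by
    change Affine.Point.map (W' := P.W) (ι.symm : K' →ₐ[P.F] K)
      (Affine.Point.map (W' := P.W) (ι : K →ₐ[P.F] K') x) = x
    rw [Affine.Point.map_map, AlgEquiv.symm_comp, hmap_id]
  have hTTi : ∀ y, T (Ti y) = y := fun y => by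
    change Affine.Point.map (W' := P.W) (ι : K →ₐ[P.F] K')
      (Affine.Point.map (W' := P.W) (ι.symm : K' →ₐ[P.F] K) y) = y
    rw [Affine.Point.map_map, AlgEquiv.comp_symm, hmap_id']
  have hTinj : Function.Injective T := fun a b hab => by
    have := congrArg Ti hab; rwa [hTiT, hTiT] at this
  -- restriction to the `m`-torsion
  have hT_mem : ∀ x : P.W.geomTorsion (m : ℤ), T (x : P.W.geomPoints) ∈ P'.W.geomTorsion (m : ℤ) :=
    fun x => by
    have hx := (Submodule.mem_torsionBy_iff (m : ℤ) (x : P.W.geomPoints)).mp x.2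
    refine (Submodule.mem_torsionBy_iff (m : ℤ) _).mpr ?_
    change (m : ℤ) • T (x : P.W.geomPoints) = 0
    rw [← map_zsmul, show (m : ℤ) • (x : P.W.geomPoints) = 0 from hx, map_zero]
  have hTi_mem : ∀ y : P'.W.geomTorsion (m : ℤ), Ti (y : P'.W.geomPoints) ∈ P.W.geomTorsion (m : ℤ) :=
    fun y => by
    have hy := (Submodule.mem_torsionBy_iff (m : ℤ) (y : P'.W.geomPoints)).mp y.2
    refine (Submodule.mem_torsionBy_iff (m : ℤ) _).mpr ?_
    change (m : ℤ) • Ti (y : P'.W.geomPoints) = 0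
    rw [← map_zsmul, show (m : ℤ) • (y : P'.W.geomPoints) = 0 from hy, map_zero]
  let Tt : P.W.geomTorsion (m : ℤ) ≃+ P'.W.geomTorsion (m : ℤ) :=
    { toFun := fun x => ⟨T (x : P.W.geomPoints), hT_mem x⟩
      invFun := fun y => ⟨Ti (y : P'.W.geomPoints), hTi_mem y⟩
      left_inv := fun x => Subtype.ext (hTiT x)
      right_inv := fun y => Subtype.ext (hTTi y)
      map_add' := fun x y => Subtype.ext (by
        change T ((x : P.W.geomPoints) + (y : P.W.geomPoints)) =
          T (x : P.W.geomPoints) + T (y : P.W.geomPoints)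
        exact map_add T (x : P.W.geomPoints) (y : P.W.geomPoints)) }
  have hTt : ∀ x : P.W.geomTorsion (m : ℤ), ((Tt x : P'.W.geomTorsion (m : ℤ)) : P'.W.geomPoints) =
      T (x : P.W.geomPoints) := fun x => rfl
  -- the `ℤ/m`-module structures and `Tt` as a linear equivalence
  letI instP : Module (ZMod m) (P.W.geomTorsion (m : ℤ)) := AddSubgroup.torsionBy.zmodModule
  letI instP' : Module (ZMod m) (P'.W.geomTorsion (m : ℤ)) := AddSubgroup.torsionBy.zmodModule
  let TL : P.W.geomTorsion (m : ℤ) ≃ₗ[ZMod m] P'.W.geomTorsion (m : ℤ) :=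
    { Tt.toAddMonoidHom.toZModLinearMap m with
      invFun := Tt.symm
      left_inv := fun x => Tt.symm_apply_apply x
      right_inv := fun y => Tt.apply_symm_apply y }
  have hTL : ∀ x, TL x = Tt x := fun x => rfl
  have hTLs : ∀ y, TL.symm y = Tt.symm y := fun y => rfl
  -- the Galois actions through `Affine.Point.map`
  have hactP' : ∀ (σ' : Field.absoluteGaloisGroup F') (y : P'.W.geomPoints),
      σ' • y = Affine.Point.map (W' := P.W)
        (((show K' ≃ₐ[F'] K' from σ').restrictScalars P.F : K' →ₐ[P.F] K')) y :=
    fun σ' y => by cases y <;> rfl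
  -- now the statement
  intro f hf
  -- transport `f` to `E[m](F̄′)`
  let f' : P'.W.geomTorsion (m : ℤ) →ₗ[ZMod m] P'.W.geomTorsion (m : ℤ) :=
    (TL : P.W.geomTorsion (m : ℤ) →ₗ[ZMod m] P'.W.geomTorsion (m : ℤ)) ∘ₗ f ∘ₗ
      (TL.symm : P'.W.geomTorsion (m : ℤ) →ₗ[ZMod m] P.W.geomTorsion (m : ℤ))
  have hf'det : LinearMap.det f' = 1 := by
    change LinearMap.det ((TL : P.W.geomTorsion (m : ℤ) →ₗ[ZMod m] P'.W.geomTorsion (m : ℤ)) ∘ₗ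
      f ∘ₗ (TL.symm : P'.W.geomTorsion (m : ℤ) →ₗ[ZMod m] P.W.geomTorsion (m : ℤ))) = 1
    rw [LinearMap.det_conj f TL, hf]
  have hf'Tt : ∀ x, f' (Tt x) = Tt (f x) := fun x => by
    change TL (f (TL.symm (TL x))) = Tt (f x)
    rw [TL.symm_apply_apply, hTL]
  obtain ⟨σ', hσ'⟩ := h f' hf'det
  -- pull `σ′` back along `ι`: `σ := ι⁻¹ ∘ σ′ ∘ ι`
  let τ : K' ≃ₐ[P.F] K' := (show K' ≃ₐ[F'] K' from σ').restrictScalars P.F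
  let σe : K ≃ₐ[P.F] K := ι.trans (τ.trans ι.symm)
  let σ : Field.absoluteGaloisGroup P.F := σe
  have hcomp : (ι : K →ₐ[P.F] K').comp (σe : K →ₐ[P.F] K) =
      (τ : K' →ₐ[P.F] K').comp (ι : K →ₐ[P.F] K') := by
    ext z
    change ι (ι.symm (τ (ι z))) = τ (ι z)
    rw [AlgEquiv.apply_symm_apply]
  refine ⟨σ, fun x => ?_⟩
  -- compare after applying the injective transport `T`
  have key : T ((σ • x : P.W.geomTorsion (m : ℤ)) : P.W.geomPoints) = σ' • T (x : P.W.geomPoints) := by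
    rw [hactP']
    change Affine.Point.map (W' := P.W) (ι : K →ₐ[P.F] K')
        (Affine.Point.map (W' := P.W) (σe : K →ₐ[P.F] K) (x : P.W.geomPoints)) =
      Affine.Point.map (W' := P.W) (τ : K' →ₐ[P.F] K')
        (Affine.Point.map (W' := P.W) (ι : K →ₐ[P.F] K') (x : P.W.geomPoints))
    rw [Affine.Point.map_map, Affine.Point.map_map, hcomp]
  have e2 : σ' • T (x : P.W.geomPoints) =
      ((σ' • Tt x : P'.W.geomTorsion (m : ℤ)) : P'.W.geomPoints) := rfl
  apply Subtype.ext
  apply hTinj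
  rw [key, e2, hσ' (Tt x), hf'Tt]
  exact hTt (f x)

/-- The same transport for the level-by-level `l`-adic statement: `SL₂(ℤ_l) ⊆ Im(Gal(Q̄/F′))` for
the base-changed presentation implies `SL₂(ℤ_l) ⊆ Im(Gal(Q̄/F))` (`EllPoint.LAdicImageContainsSL2` of
`GenEllPrimesPrescribed.lean`). [cite: MochizukiGenEll2010, Thm 3.8 p.20] -/
theorem lAdicImageContainsSL2_of_baseChange (l : ℕ) [Fact l.Prime]
    (h : (EllPoint.mk F' (P.W.map (algebraMap P.F F'))).LAdicImageContainsSL2 l) :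
    P.LAdicImageContainsSL2 l :=
  fun n hn => P.imageModLContainsSL2_of_baseChange F' (l ^ n) (h n hn)

end EllPoint

end Literature.NumberTheory.DiophantineGeometry.GenEll

end
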